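/-
Copyright (c) 2026. All rights reserved.
Released under Apache 2.0 license as described in the file LICENSE.
Authors: HodgeCM publication cell (pub-hodgecm), GR lane, seat GR-2 (`pub-hodgecm-own-hyp34`).
-/
import Literature.NumberTheory.Weil1964.ArchComplexPlaceRealification
import Literature.NumberTheory.Weil1964.ArchPlaceLeviSection
import HarnessLib

/-!
# The archimedean Weil section of `U(J)(E ⊗ ℝ)` over the COMPLEX places of `F` (all of them at once)

Topic `NumberTheory/Weil1964`; namespace `Literature.NumberTheory.Weil1964`.  KERNEL ONLY: definitions with bodies and
theorems; no `def … : Prop` record, no `axiom`, no proof hole.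

Setting: `E/F` quadratic with involution `c` (`hcc : c * c = 1`), `J = T₀ ⊗_F E` with `T₀ ∈ M_N(F)` symmetric and
`IsUnit T₀.det`, `δ ∈ E` non-zero with `c δ = -δ`, and for every COMPLEX place `v` of `F` a chosen place `w(v)` of `E`
over it (`hover`).  At such a place the factor of `U(J)(E ⊗ ℝ)` is `GL_N(ℂ) ∋ g_{w(v)}`
(`UnitaryGroupArchComplexPair.archAtComplexSplit`), and in the complex Folland frame (`C = 1`) its symplectic action is
`κ_v⁻¹ · m(Res g_{w(v)}) · κ_v` (`ArchComplexPlaceRealification.cxRealify_toSymplectic`).  Hence, with the index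
`(Fin N ⊕ Fin N) × {v complex}` of the complex block of the frame `ArchFollandFrameGen.FrameIdx`:

* §1 the Levi family **`cxLeviFamily : U(J)(E ⊗ ℝ) →* ({v complex} → GL_{N ⊕ N}(ℝ))`**, `g ↦ (Res g_{w(v)})_v`
  (continuous, with continuous inverses), and the Cayley family `cxKappaFamily v = cxCayley_v`;
* §2 **`cxPlacesSection x := placeLeviSection (cxLeviFamily) x : U(J)(E ⊗ ℝ) →* Mp^𝓢(ℝ^{(N⊕N)×{v complex}})`** for a
  lift `x` of `placeSp (κ⁻¹)` (`exists_cxPlacesSection_lift`): it lies over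
  `g ↦ placePhase (v ↦ cxRealify 1 (σ_{w(v)} T₀) (toSymplectic (archAtComplexSplit w(v) g)))`
  (`coe_proj_cxPlacesSection`) — by `ArchActQuadraticComplexPlaces` + `ArchFollandFrameTwist` exactly the complex slices
  of the archimedean phase map of `ι_𝔸(g, 1)` (the sequel's dictionary) — and is strongly continuous
  (`continuous_cxPlacesSection_snd_apply`, the `hsc` input of `AdelicMetaplecticArchSection.continuous_archLift`).

[MoeglinVignerasWaldspurger1987, Chap. 1 I.17–I.19, Chap. 2 II.2]; [Folland1989, §4.2 (4.24)]; [Kudla1994, §3].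

## References
* [MoeglinVignerasWaldspurger1987] C. Mœglin, M.-F. Vignéras, J.-L. Waldspurger, LNM 1291 (1987), Chap. 1 I.17–I.19,
  Chap. 2 II.2.
* [Folland1989] G. B. Folland, *Harmonic Analysis in Phase Space*, Princeton UP (1989), §4.2 (4.24).
* [Kudla1994] S. S. Kudla, Israel J. Math. 87 (1994), §3.
-/

set_option autoImplicit false

noncomputable section

open scoped Matrix ComplexConjugate Classical
open Matrix NumberField NumberField.InfinitePlace NumberField.mixedEmbedding
open Literature.RepresentationTheory.HeisenbergGroup
open Literature.RepresentationTheory.HeisenbergGroup.SymplecticMatrix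
open Literature.Analysis.SegalBargmann
open Literature.NumberTheory.Automorphic Literature.NumberTheory.Automorphic.UnitaryGroup
open Literature.RepresentationTheory.KonnoKonno2007

namespace Literature.NumberTheory.Weil1964

local notation "PV" σ => (σ → ℝ) × (σ → ℝ)
local notation "SpR" σ => symplecticGroup (polar (dotPairing σ))

variable (F : Type) [Field F] [NumberField F] (E : Type) [Field E] [NumberField E] [Algebra F E] (c : E ≃ₐ[F] E)
  (hcc : c * c = 1)
  (N : ℕ) (T₀ : Matrix (Fin N) (Fin N) F) (hT : T₀.IsSymm) (hTd : IsUnit T₀.det)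
  {J : Matrix (Fin N) (Fin N) E} (hJ : J = T₀.map (algebraMap F E)) {δ : E} (hδ : δ ≠ 0)
  (wOf : {v : InfinitePlace F // v.IsComplex} → {w : InfinitePlace E // w.IsComplex})

/-! ## §1 The Levi family over the complex places -/

section Family

/-- the Gram matrix of the factor at `v`: `σ_{w(v)}(T₀) ∈ M_N(ℂ)`. [cite: MoeglinVignerasWaldspurger1987, Chap. 1 I.17] -/
abbrev cxGram (v : {v : InfinitePlace F // v.IsComplex}) : Matrix (Fin N) (Fin N) ℂ := T₀.map (cxEmbOfPlace F E (wOf v))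

omit [NumberField F] [NumberField E] in
include hTd in
/-- `det σ_{w(v)}(T₀)` is a unit. [cite: MoeglinVignerasWaldspurger1987, Chap. 1 I.17] -/
theorem isUnit_det_cxGram (v : {v : InfinitePlace F // v.IsComplex}) : IsUnit (cxGram F E N T₀ wOf v).det :=
  isUnit_det_map _ hTd

omit [NumberField F] [NumberField E] in
include hT in
/-- `σ_{w(v)}(T₀)` is symmetric. [cite: MoeglinVignerasWaldspurger1987, Chap. 1 I.17] -/
theorem isSymm_cxGram (v : {v : InfinitePlace F // v.IsComplex}) : (cxGram F E N T₀ wOf v).IsSymm := hT.map _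

/-- the parameter `s_v = σ_{w(v)}(δ)` of the split coordinates at `v`. [cite: MoeglinVignerasWaldspurger1987, Chap. 1 I.17] -/
abbrev cxDelta (δ : E) (v : {v : InfinitePlace F // v.IsComplex}) : ℂ := (wOf v).1.embedding δ

omit [NumberField F] [NumberField E] [Algebra F E] in
include hδ in
/-- `s_v ≠ 0`. [cite: MoeglinVignerasWaldspurger1987, Chap. 1 I.17] -/
theorem cxDelta_ne_zero (v : {v : InfinitePlace F // v.IsComplex}) : cxDelta F E wOf δ v ≠ 0 :=
  embedding_ne_zero E (wOf v) hδ

/-- **the Levi family** `g ↦ (Res (g_{w(v)}))_v ∈ ∏_v GL_{N ⊕ N}(ℝ)` (`g₊ = plusGL (archAtComplexSplit w(v) g) = g_{w(v)}`,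
realified). [cite: Folland1989, §4.2 (4.24); MoeglinVignerasWaldspurger1987, Chap. 2 II.2] -/
def cxLeviFamily : arch F E c N J →* ({v : InfinitePlace F // v.IsComplex} → GL (Fin N ⊕ Fin N) ℝ) :=
  MonoidHom.pi fun v =>
    (resGL (Fin N)).comp ((((isQuadraticCoordinates_splitPair (cxDelta F E wOf δ v) (cxDelta_ne_zero F E hδ wOf v)).plusGL
      rfl (Fin N)).comp (unitaryGroupOfForm _ _).subtype).comp (archAtComplexSplit F E c N hcc (wOf v) T₀ hJ))

omit [NumberField F] [NumberField E] in
/-- the component at `v`. [cite: Folland1989, §4.2 (4.24)] -/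
theorem cxLeviFamily_apply (g : arch F E c N J) (v : {v : InfinitePlace F // v.IsComplex}) :
    cxLeviFamily F E c hcc N T₀ hJ hδ wOf g v =
      resGL (Fin N) ((isQuadraticCoordinates_splitPair (cxDelta F E wOf δ v) (cxDelta_ne_zero F E hδ wOf v)).plusGL rfl
        (Fin N) (archAtComplexSplit F E c N hcc (wOf v) T₀ hJ g : unitaryGroupOfForm _ _)) := rfl

omit [NumberField F] [NumberField E] in
/-- continuity of `g ↦ g₊` at `v` into `GL_N(ℂ)`. [cite: BorelJacquet1979, §4.1] -/
theorem continuous_plusGL_archAtComplexSplit (v : {v : InfinitePlace F // v.IsComplex}) :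
    Continuous fun g : arch F E c N J =>
      (isQuadraticCoordinates_splitPair (cxDelta F E wOf δ v) (cxDelta_ne_zero F E hδ wOf v)).plusGL rfl (Fin N)
        (archAtComplexSplit F E c N hcc (wOf v) T₀ hJ g : unitaryGroupOfForm _ _) := by
  have hev : Continuous ((isQuadraticCoordinates_splitPair (cxDelta F E wOf δ v) (cxDelta_ne_zero F E hδ wOf v)).evalPlus
      rfl : ℂ × ℂ → ℂ) :=
    continuous_fst.congr fun z => (evalPlus_splitPair _ _ z).symm
  exact ((hev.generalLinearGroup_map : Continuous (Matrix.GeneralLinearGroup.map (n := Fin N) _)).comp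
    continuous_subtype_val).comp (continuous_archAtComplexSplit F E c N hcc (wOf v) T₀ hJ)

omit [NumberField F] [NumberField E] in
/-- the component at `v` is entrywise continuous. [cite: BorelJacquet1979, §4.1] -/
theorem continuous_coe_cxLeviFamily (v : {v : InfinitePlace F // v.IsComplex}) :
    Continuous fun g : arch F E c N J =>
      ((cxLeviFamily F E c hcc N T₀ hJ hδ wOf g v : GL (Fin N ⊕ Fin N) ℝ) : Matrix (Fin N ⊕ Fin N) (Fin N ⊕ Fin N) ℝ) := by
  simp only [cxLeviFamily_apply, coe_resGL]
  exact continuous_resMat.comp (Units.continuous_val.comp (continuous_plusGL_archAtComplexSplit F E c hcc N T₀ hJ hδ wOf v))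

omit [NumberField F] [NumberField E] in
/-- the inverse of the component at `v` is entrywise continuous. [cite: BorelJacquet1979, §4.1] -/
theorem continuous_coe_cxLeviFamily_inv (v : {v : InfinitePlace F // v.IsComplex}) :
    Continuous fun g : arch F E c N J =>
      (((cxLeviFamily F E c hcc N T₀ hJ hδ wOf g v)⁻¹ : GL (Fin N ⊕ Fin N) ℝ) : Matrix (Fin N ⊕ Fin N) (Fin N ⊕ Fin N) ℝ) := by
  simp only [cxLeviFamily_apply, coe_resGL_inv]
  exact continuous_resMat.comp (Units.continuous_coe_inv.comp (continuous_plusGL_archAtComplexSplit F E c hcc N T₀ hJ hδ wOf v))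

/-- **the Cayley family** `κ_v = cxCayley (σ_{w(v)} T₀)`. [cite: MoeglinVignerasWaldspurger1987, Chap. 2 III.1] -/
def cxKappaFamily (v : {v : InfinitePlace F // v.IsComplex}) : SpR (Fin N ⊕ Fin N) :=
  cxCayley (cxGram F E N T₀ wOf v) (isUnit_det_cxGram F E N T₀ hTd wOf v) (cxDelta_ne_zero F E hδ wOf v)
    (isSymm_cxGram F E N T₀ hT wOf v)

end Family

/-! ## §2 The section over the complex places -/

section Section

/-- **`cxPlacesSection x : U(J)(E ⊗ ℝ) →* Mp^𝓢(ℝ^{(N ⊕ N) × {v complex}})`** — the conjugated Levi section over all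
complex places of `F` at once. [cite: Folland1989, §4.2 (4.24); Kudla1994, §3] -/
def cxPlacesSection (x : MpS ((Fin N ⊕ Fin N) × {v : InfinitePlace F // v.IsComplex})) :
    arch F E c N J →* MpS ((Fin N ⊕ Fin N) × {v : InfinitePlace F // v.IsComplex}) :=
  placeLeviSection (Fin N ⊕ Fin N) {v : InfinitePlace F // v.IsComplex} (cxLeviFamily F E c hcc N T₀ hJ hδ wOf) x

omit [NumberField E] in
/-- **a lift of `placeSp κ⁻¹` exists.** [cite: Folland1989, §4.2 Prop. (4.39)] -/
theorem exists_cxPlacesSection_lift :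
    ∃ x : MpS ((Fin N ⊕ Fin N) × {v : InfinitePlace F // v.IsComplex}),
      MpS.proj x = placeSp fun v => (cxKappaFamily F E N T₀ hT hTd hδ wOf v)⁻¹ :=
  exists_placeLeviSection_lift _

omit [NumberField E] in
/-- **THE SECTION LIES OVER THE REALIFIED FACTORS**: for a lift `x` of `placeSp κ⁻¹`,
`⇑(proj (cxPlacesSection x g)) = placePhase (v ↦ ⇑(cxRealify 1 (σ_{w(v)} T₀) (toSymplectic (archAtComplexSplit w(v) g))))`.
[cite: Kudla1994, §3; MoeglinVignerasWaldspurger1987, Chap. 2 II.2] -/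
theorem coe_proj_cxPlacesSection (x : MpS ((Fin N ⊕ Fin N) × {v : InfinitePlace F // v.IsComplex}))
    (hx : MpS.proj x = placeSp fun v => (cxKappaFamily F E N T₀ hT hTd hδ wOf v)⁻¹) (g : arch F E c N J) :
    (⇑(((MpS.proj (cxPlacesSection F E c hcc N T₀ hJ hδ wOf x g) : SpR ((Fin N ⊕ Fin N) × {v : InfinitePlace F // v.IsComplex})).1 :
        (PV ((Fin N ⊕ Fin N) × {v : InfinitePlace F // v.IsComplex})) ≃ₗ[ℝ]
          PV ((Fin N ⊕ Fin N) × {v : InfinitePlace F // v.IsComplex}))) :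
        PhaseMap ((Fin N ⊕ Fin N) × {v : InfinitePlace F // v.IsComplex})) =
      placePhase fun v => ⇑(((cxRealify (fun _ => (1 : ℂ)) one_scale_ne_zero (cxGram F E N T₀ wOf v)
          (isUnit_det_cxGram F E N T₀ hTd wOf v)
          ((isQuadraticCoordinates_splitPair (cxDelta F E wOf δ v) (cxDelta_ne_zero F E hδ wOf v)).toSymplectic (Fin N)
            (isSymm_cxGram F E N T₀ hT wOf v) (swap_pair_diag (K := ℂ)) (swap_pair_delta (cxDelta F E wOf δ v)) rfl
            (archAtComplexSplit F E c N hcc (wOf v) T₀ hJ g)) : SpR (Fin N ⊕ Fin N)).1 :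
          (PV (Fin N ⊕ Fin N)) ≃ₗ[ℝ] PV (Fin N ⊕ Fin N))) := by
  rw [cxPlacesSection, coe_proj_placeLeviSection _ _ x hx]
  congr 1
  funext v
  rw [cxRealify_toSymplectic (cxGram F E N T₀ wOf v) (isUnit_det_cxGram F E N T₀ hTd wOf v)
    (cxDelta_ne_zero F E hδ wOf v) (isSymm_cxGram F E N T₀ hT wOf v) rfl]
  rfl

omit [NumberField E] in
/-- **strong continuity** of the section (the `hsc` input of `continuous_archLift`).
[cite: Folland1989, §4.2 (4.24); Weil1964, Chap. III n° 39 p. 189] -/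
theorem continuous_cxPlacesSection_snd_apply (x : MpS ((Fin N ⊕ Fin N) × {v : InfinitePlace F // v.IsComplex}))
    (f : SchwartzMap ((Fin N ⊕ Fin N) × {v : InfinitePlace F // v.IsComplex} → ℝ) ℂ) :
    Continuous fun g : arch F E c N J => (cxPlacesSection F E c hcc N T₀ hJ hδ wOf x g).1.2 f :=
  continuous_placeLeviSection_snd_apply _ x (continuous_coe_cxLeviFamily_inv F E c hcc N T₀ hJ hδ wOf) f

omit [NumberField E] in
/-- continuity of the `π`-orbit maps of the section. [cite: Weil1964, Chap. III n° 39 p. 189] -/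
theorem continuous_proj_cxPlacesSection_apply (x : MpS ((Fin N ⊕ Fin N) × {v : InfinitePlace F // v.IsComplex}))
    (w : PV ((Fin N ⊕ Fin N) × {v : InfinitePlace F // v.IsComplex})) :
    Continuous fun g : arch F E c N J =>
      ((MpS.proj (cxPlacesSection F E c hcc N T₀ hJ hδ wOf x g) : SpR ((Fin N ⊕ Fin N) × {v : InfinitePlace F // v.IsComplex})) :
        (PV ((Fin N ⊕ Fin N) × {v : InfinitePlace F // v.IsComplex})) ≃ₗ[ℝ]
          PV ((Fin N ⊕ Fin N) × {v : InfinitePlace F // v.IsComplex})) w :=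
  continuous_proj_placeLeviSection_apply _ x (continuous_coe_cxLeviFamily F E c hcc N T₀ hJ hδ wOf)
    (continuous_coe_cxLeviFamily_inv F E c hcc N T₀ hJ hδ wOf) w

omit [NumberField E] in
/-- **independence of the lift.** [cite: Kudla1996, Chap. I §2 Remark] -/
theorem cxPlacesSection_eq_of_proj_eq {x y : MpS ((Fin N ⊕ Fin N) × {v : InfinitePlace F // v.IsComplex})}
    (hxy : MpS.proj x = MpS.proj y) :
    cxPlacesSection F E c hcc N T₀ hJ hδ wOf y = cxPlacesSection F E c hcc N T₀ hJ hδ wOf x :=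
  placeLeviSection_eq_of_proj_eq _ hxy

end Section

end Literature.NumberTheory.Weil1964

end
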